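import Literature.Probability.RandomPlanarGeometry.ChordalLERWScalingLimit
import Literature.Probability.LatticeModels.LoopErasedWalkIdentity
import HarnessLib

/-!
# Chordal LERW ⟶ SLE₂ (Lawler–Viklund 2021): proofs, part 1 — the loop-erased measure of `(A, a, b)` and its domain Markov property

Topic `Probability/RandomPlanarGeometry`; namespace
`Literature.Probability.RandomPlanarGeometry.ChordalLERW`. Second layer of the proof programme
for the named fact `ChordalLERW.lawlerViklund_tendsto_sle_two` (`ChordalLERWScalingLimit.lean`;
[LawlerViklund2021] §2.3, Theorem "main_complete", forgetting the parametrisation). It renders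
the two structural facts about the LERW law `P_{A,a,b}` of [LawlerViklund2021] §2.1 and §2.3 on
which every later step (the martingale observable of [LV_lerw_chordal_note]/[LSW04] §3, and the
Kemppainen–Smirnov crossing condition for LERW) is built:

* §2.1 (p. 7): "`P̂_{A,a,b}(η) = ∑_{ω ∈ 𝒦_A(a,b) : LE(ω) = η} p(ω)` … Note that
  `P̂_{A,a,b}[𝒲_A(a,b)] = H_{∂A}(a,b)`. Let `P_{A,a,b} = P̂_{A,a,b}/H_{∂A}(a,b)` … the probability
  law of loop-erased random walk (LERW) in `A` from `a` to `b`." Here, on the interior walks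
  `ω ∈ 𝒦_A(a₊, b₊)` (the two half-edges and the factor `1/16` cancel, see the fact file):
  `leWeight A L = ∑_{w ⊆ A, LE(w) = L} 4^{-|w|}` (Lawler's `q̂`, the tree's
  `LoopErasedWalkIdentity.lesum` on `siteGraph A`), `tsum_walk_ite_loopErase_eq` (the same sum
  over the walks `a₊ → b₊` of `siteGraph A`), `tsum_leWeight_eq_rwGreen` (total mass
  `G_A(a₊,b₊)`: the fibres of `LE` partition `𝒦_A(a₊,b₊)`), and `law_eq_sum_leWeight` (the
  curve law `ChordalLERW.law` is the image of `leWeight/G_A` under `η ↦ η^N`).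
* §2.3 (p. 9): "If `η = [η₀,…,η_k] ∈ 𝒲_A(a,b)`, let `η^j = [η₀,…,η_j]`, `A_j = A ∖ η^j` and
  `a_j = [η_j + η_{j+1}]/2` so that `a_j ∈ ∂ₑA_j`. The tuples `(A_j, a_j, b)` form a sequence of
  decreasing discrete domains with two marked boundary edges", used throughout §3.2 ("the
  conditional distribution of `(A_n, a_n, b)` given `(A_{n-1}, a_{n-1}, b)` is that of the LERW
  probability measure `P_{n-1}` … stopped") — i.e. the **domain Markov property** of chordal
  LERW (Lawler, *Conformally invariant processes* (2005) §7? / Lawler 2018, Prop. 3.1):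
  `leWeight_append_cons` — for a self-avoiding nearest-neighbour prefix `[η₁,…,η_j, y]` in `A`,
  `q̂_A([η₁,…,η_j] ⊕ (y :: rest)) = C_A(η₁,…,η_j) · q̂_{A ∖ {η₁,…,η_j}}(y :: rest)` with the
  explicit constant `prefixWeight A [η₁,…,η_j] = ∏ᵢ G_{A∖{η₁…η_{i-1}}}(ηᵢ,ηᵢ)/4` (Lawler 2018,
  proof of Prop. 3.1: the tree's `lesum_cons`, iterated, plus the identification of walks in
  `A` avoiding `S` with walks in `A ∖ S`, `lesum_siteGraph_eq_leWeight_diff`). Dividing by the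
  total masses, the conditional law of the remainder of the LERW given the prefix is
  `P_{A_j, a_j, b}` with `A_j = A ∖ {η₁,…,η_j}`, `a_j = (η_j, y)`
  (`prefixMass_eq`: `P_{A,a,b}{prefix} = C_A · G_{A_j}(y,b₊)/G_A(a₊,b₊)`).

## References

* G. F. Lawler, F. Viklund, Duke Math. J. 170 (2021), §2.1, §2.3, §3.2 (arXiv:1603.05203,
  pp. 7, 9, 11) [LawlerViklund2021].
* G. F. Lawler, Probab. Surveys 15 (2018), §3, Prop. 3.1 and its proof [Lawler2018].
-/

noncomputable section

open MeasureTheory Filter Set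
open _root_.Topology
open scoped ENNReal NNReal Classical
open Literature.Probability.LatticeModels
open Literature.Probability.LatticeModels.LoopErasedWalkIdentity

namespace Literature.Probability.RandomPlanarGeometry

namespace ChordalLERW

/-! ### The loop-erased measure `q̂_A` on interior vertex lists -/

/-- **The loop-erased measure** `q̂_A(L) = ∑_{w ⊆ A : LE(w) = L} 4^{-|w|}` of a vertex list `L`
([LawlerViklund2021] §2.1 `P̂_{A,a,b}`, on the interior walks; Lawler 2018, §3 Def. 2): the sum of
`4^{-(number of steps)}` over the nearest-neighbour vertex lists `w` in `A` whose chronological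
loop erasure is `L` — the tree's `lesum` for `siteGraph A`, weight `1/4`, nothing removed.
[cite: LawlerViklund2021, §2.1] -/
def leWeight (A : Set (Site 2)) (L : List (Site 2)) : ℝ≥0∞ :=
  lesum (siteGraph A) 4⁻¹ ∅ L

/-- **The weight of a removed prefix** `C_A([η₁,…,η_j]) = ∏_{i=1}^{j} G_{A∖{η₁,…,η_{i-1}}}(ηᵢ,ηᵢ) · 4^{-1}`
(Lawler 2018, Prop. 3.1: the loops at `ηᵢ` in `A ∖ {η₁,…,η_{i-1}}` and the step `[ηᵢ, η_{i+1}]`),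
by recursion on the prefix. [cite: Lawler2018, Proposition 3.1] -/
def prefixWeight : Set (Site 2) → List (Site 2) → ℝ≥0∞
  | _, [] => 1
  | A, x :: p => green (siteGraph A) 4⁻¹ ∅ x * 4⁻¹ * prefixWeight (A \ {x}) p

/-- `prefixWeight` of the empty prefix. [folklore] -/
@[simp] theorem prefixWeight_nil (A : Set (Site 2)) : prefixWeight A [] = 1 := rfl

/-- `prefixWeight` of a prefix with a first vertex. [folklore] -/
@[simp] theorem prefixWeight_cons (A : Set (Site 2)) (x : Site 2) (p : List (Site 2)) :
    prefixWeight A (x :: p) = green (siteGraph A) 4⁻¹ ∅ x * 4⁻¹ * prefixWeight (A \ {x}) p := rfl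

/-- `q̂_A` in this file's vocabulary: the sum over nearest-neighbour vertex lists `w` in `A` with
`LE(w) = L` of `4^{-(|w|-1)}` (the tree's `lesum` unfolded; loop erasure does not depend on the
decidability instance used to compute it, `loopErase_eq_loopErase`). [folklore] -/
theorem leWeight_eq_tsum (A : Set (Site 2)) (L : List (Site 2)) :
    leWeight A L = ∑' w : List (Site 2),
      if List.IsChain (siteGraph A).Adj w ∧ loopErase w = L then (4⁻¹ : ℝ≥0∞) ^ (w.length - 1)
      else 0 := by
  unfold leWeight lesum
  refine tsum_congr fun w => ite_congr_prop _ _ ?_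
  constructor
  · rintro ⟨hc, -, hle⟩
    exact ⟨hc, (loopErase_eq_loopErase _ _ w).trans hle⟩
  · rintro ⟨hc, hle⟩
    exact ⟨hc, avoids_empty w, (loopErase_eq_loopErase _ _ w).trans hle⟩

/-! ### Walks in `A` avoiding `S` are the walks in `A ∖ S` -/

/-- For a vertex list avoiding `S`, being a nearest-neighbour chain in `A` is being one in `A ∖ S`.
[folklore] -/
theorem isChain_siteGraph_iff_of_avoids {A S : Set (Site 2)} {w : List (Site 2)} (hw : Avoids S w) :
    List.IsChain (siteGraph A).Adj w ↔ List.IsChain (siteGraph (A \ S)).Adj w := by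
  refine List.IsChain.iff_of_mem_imp fun x y hx hy => ?_
  rw [siteGraph_adj_iff, siteGraph_adj_iff]
  have hxS := hw x hx
  have hyS := hw y hy
  simp only [Set.mem_sdiff]
  tauto

/-- A nearest-neighbour chain of `A ∖ S` with at least two vertices avoids `S` (every vertex is an
endpoint of a step). [folklore] -/
theorem avoids_of_isChain_siteGraph_diff {A S : Set (Site 2)} :
    ∀ {w : List (Site 2)}, List.IsChain (siteGraph (A \ S)).Adj w → 2 ≤ w.length → Avoids S w
  | [], _, h => by simp at h
  | [_], _, h => by simp at h
  | a :: b :: t, hw, _ => by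
    rw [List.isChain_cons_cons] at hw
    have hab := siteGraph_adj_iff.1 hw.1
    rw [avoids_cons]
    refine ⟨hab.2.1.2, ?_⟩
    cases t with
    | nil => simpa [Avoids] using hab.2.2.2
    | cons c t => exact avoids_of_isChain_siteGraph_diff hw.2 (by simp)

/-- **Removing visited sites = shrinking the domain**: Lawler's `q̂` in `A` with the sites of `S`
removed is `q̂_{A∖S}` (for lists not starting in `S`; [LawlerViklund2021] §2.3 "`A_j = A ∖ η^j`").
[cite: LawlerViklund2021, §2.3] -/
theorem lesum_siteGraph_eq_leWeight_diff {A S : Set (Site 2)} {L : List (Site 2)}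
    (hL : ∀ x ∈ L.head?, x ∉ S) :
    lesum (siteGraph A) 4⁻¹ S L = leWeight (A \ S) L := by
  rw [leWeight_eq_tsum]
  unfold lesum
  refine tsum_congr fun w => ite_congr_prop _ _ ?_
  constructor
  · rintro ⟨hc, hS, hle⟩
    exact ⟨(isChain_siteGraph_iff_of_avoids hS).1 hc, (loopErase_eq_loopErase _ _ w).trans hle⟩
  · rintro ⟨hc, hle⟩
    have hS : Avoids S w := by
      rcases Nat.lt_or_ge w.length 2 with hlt | hge
      · match w, hlt, hle with
        | [], _, _ => exact avoids_nil S
        | [x], _, hle =>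
          rw [loopErase_singleton] at hle
          subst hle
          intro v hv
          simp only [List.mem_singleton] at hv
          subst hv
          exact hL v rfl
        | _ :: _ :: _, hlt, _ => simp at hlt
      · exact avoids_of_isChain_siteGraph_diff hc hge
    exact ⟨(isChain_siteGraph_iff_of_avoids hS).2 hc, hS, (loopErase_eq_loopErase _ _ w).trans hle⟩

/-! ### The domain Markov property -/

/-- **Domain Markov property of chordal LERW** (weights form; [LawlerViklund2021] §2.3 / §3.2,
Lawler 2018 Prop. 3.1): for a self-avoiding nearest-neighbour prefix `pfx ++ [y]` in `A`, the
loop-erased measure of the paths continuing it factorises as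
`q̂_A(pfx ++ y :: rest) = C_A(pfx) · q̂_{A ∖ pfx}(y :: rest)`, the second factor being the
loop-erased measure of the SMALLER domain `A_j = A ∖ pfx` started from `y = η_{j+1} ∈ A_j` (the
inner endpoint of the new boundary edge `a_j = (η_j, η_{j+1})`). [cite: LawlerViklund2021, §2.3] -/
theorem leWeight_append_cons :
    ∀ (A : Set (Site 2)) (pfx : List (Site 2)) (y : Site 2) (rest : List (Site 2)),
      List.IsChain (siteGraph A).Adj (pfx ++ [y]) → (pfx ++ [y]).Nodup →
      leWeight A (pfx ++ y :: rest) =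
        prefixWeight A pfx * leWeight (A \ {v | v ∈ pfx}) (y :: rest)
  | A, [], y, rest, _, _ => by
    have h0 : A \ {v : Site 2 | v ∈ ([] : List (Site 2))} = A := by ext; simp
    rw [h0, List.nil_append, prefixWeight_nil, one_mul]
  | A, x :: p, y, rest, hch, hnd => by
    rw [List.cons_append] at hch hnd
    rw [List.nodup_cons] at hnd
    obtain ⟨hx, hnd'⟩ := hnd
    -- the head of `p ++ y :: rest` is the head of `p ++ [y]`, a neighbour of `x` other than `x`
    have hhead : (p ++ y :: rest).head? = (p ++ [y]).head? := by
      rw [List.head?_append, List.head?_append]; rfl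
    have hadj : ∀ c ∈ (p ++ y :: rest).head?, (siteGraph A).Adj x c := by
      rw [hhead]; exact (List.isChain_cons.1 hch).1
    have hne : ∀ c ∈ (p ++ y :: rest).head?, c ∉ ({x} : Set (Site 2)) := by
      rw [hhead]
      intro c hc hcx
      rw [mem_singleton_iff] at hcx
      subst hcx
      exact hx (List.mem_of_mem_head? hc)
    -- peel off the first loop and the first step (Lawler's Prop. 3.1), then shrink the domain
    have step1 : leWeight A (x :: (p ++ y :: rest)) =
        green (siteGraph A) 4⁻¹ ∅ x * 4⁻¹ * leWeight (A \ {x}) (p ++ y :: rest) := by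
      unfold leWeight
      rw [lesum_cons (Set.notMem_empty x) (by simp) hadj, insert_empty_eq,
        lesum_siteGraph_eq_leWeight_diff hne]
      rfl
    -- induction hypothesis in the domain `A ∖ {x}`
    have hch' : List.IsChain (siteGraph (A \ {x})).Adj (p ++ [y]) := by
      refine (isChain_siteGraph_iff_of_avoids ?_).1 (List.isChain_cons.1 hch).2
      intro v hv hvx
      rw [mem_singleton_iff] at hvx
      subst hvx
      exact hx hv
    have ih := leWeight_append_cons (A \ {x}) p y rest hch' hnd'
    have hset : (A \ {x}) \ {v : Site 2 | v ∈ p} = A \ {v : Site 2 | v ∈ x :: p} := by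
      rw [Set.sdiff_sdiff]
      congr 1
      ext v
      simp
    rw [List.cons_append, step1, ih, hset, prefixWeight_cons]
    ring

/-! ### `q̂_A` summed over the walks `a₊ → b₊`, its total mass, and the curve law -/

/-- The loop-erased measure read on the walks of `siteGraph A` from `z` to `w`: for a list `L`
from `z` to `w`, `∑_{ω : z → w, LE(ω) = L} 4^{-|ω|} = q̂_A(L)`; for other `L` the sum vanishes
(loop erasure keeps both endpoints). [cite: LawlerViklund2021, §2.1] -/
theorem tsum_walk_ite_loopErase_eq (A : Set (Site 2)) (z w : Site 2) (L : List (Site 2)) :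
    (∑' ω : (siteGraph A).Walk z w,
        (if loopErase ω.support = L then (4⁻¹ : ℝ≥0∞) ^ ω.length else 0)) =
      if L.head? = some z ∧ L.getLast? = some w then leWeight A L else 0 := by
  by_cases hL : L.head? = some z ∧ L.getLast? = some w
  · rw [if_pos hL,
      tsum_walk_eq_tsum_list (siteGraph A) z w (fun l n => if loopErase l = L then 4⁻¹ ^ n else 0),
      leWeight_eq_tsum]
    refine tsum_congr fun l => ?_
    have key : (List.IsChain (siteGraph A).Adj l ∧ l.head? = some z ∧ l.getLast? = some w) ∧
        loopErase l = L ↔ List.IsChain (siteGraph A).Adj l ∧ loopErase l = L := by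
      constructor
      · rintro ⟨⟨hc, -, -⟩, hle⟩
        exact ⟨hc, hle⟩
      · rintro ⟨hc, hle⟩
        refine ⟨⟨hc, ?_, ?_⟩, hle⟩
        · rw [← head?_loopErase, hle, hL.1]
        · rw [← getLast?_loopErase, hle, hL.2]
    split_ifs <;> first | rfl | (exfalso; tauto)
  · rw [if_neg hL]
    refine ENNReal.tsum_eq_zero.2 fun ω => if_neg fun hle => hL ?_
    constructor
    · rw [← hle, head?_loopErase, List.head?_eq_some_head ω.support_ne_nil,
        SimpleGraph.Walk.head_support]
    · rw [← hle, getLast?_loopErase, List.getLast?_eq_some_getLast ω.support_ne_nil,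
        SimpleGraph.Walk.getLast_support]

/-- **`P̂_{A,a,b}[𝒲_A(a,b)] = H_{∂A}(a,b)`** on the interior walks: the total loop-erased mass of
the lists from `z` to `w` is the Green's function `G_A(z,w)` (the fibres of `LE` partition
`𝒦_A(z,w)`; [LawlerViklund2021] §2.1). [cite: LawlerViklund2021, §2.1] -/
theorem tsum_leWeight_eq_rwGreen (A : Set (Site 2)) (z w : Site 2) :
    (∑' L : List (Site 2), if L.head? = some z ∧ L.getLast? = some w then leWeight A L else 0) =
      rwGreen (siteGraph A) z w := by
  simp_rw [← tsum_walk_ite_loopErase_eq]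
  rw [ENNReal.tsum_comm, rwGreen]
  refine tsum_congr fun ω => ?_
  rw [tsum_ite_eq', one_div]

/-- **The curve law is the image of `q̂_A/G_A`**: `ChordalLERW.law N A a b` is `G_A(a₊,b₊)⁻¹`
times the sum over vertex lists `L` from `a₊` to `b₊` of `q̂_A(L) · δ_{L^N}`, `L^N` the scaled
polyline from `a` through `L` to `b` ([LawlerViklund2021] §2.3 "`P^N_{A,a,b}` … the probability
measure obtained from `P_{A,a,b}` by considering the curves scaled as above").
[cite: LawlerViklund2021, §2.3] -/
theorem law_eq_sum_leWeight (N : ℝ) (A : Set (Site 2)) (a b : Site 2 × Site 2) :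
    law N A a b = (rwGreen (siteGraph A) a.2 b.2)⁻¹ •
      Measure.sum fun L : List (Site 2) =>
        (if L.head? = some a.2 ∧ L.getLast? = some b.2 then leWeight A L else 0) •
          Measure.dirac (scaledCurve N a b L) := by
  rw [law]
  congr 1
  ext s hs
  simp only [Measure.sum_apply _ hs, Measure.smul_apply, smul_eq_mul]
  simp_rw [← tsum_walk_ite_loopErase_eq, ← ENNReal.tsum_mul_right]
  rw [ENNReal.tsum_comm]
  refine tsum_congr fun ω => ?_
  have : ∀ L : List (Site 2),
      (if loopErase ω.support = L then (4⁻¹ : ℝ≥0∞) ^ ω.length else 0) *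
          Measure.dirac (scaledCurve N a b L) s =
        if loopErase ω.support = L then
          (4⁻¹ : ℝ≥0∞) ^ ω.length * Measure.dirac (scaledCurve N a b (loopErase ω.support)) s
        else 0 := by
    intro L
    split_ifs with h
    · rw [h]
    · rw [zero_mul]
  simp_rw [this]
  rw [tsum_ite_eq', one_div]

/-- **The prefix probabilities of chordal LERW** ([LawlerViklund2021] §2.3/§3.2; Lawler 2018
Prop. 3.1): the `q̂_A`-mass of the lists from `η₁` to `w` that begin with the self-avoiding
prefix `pfx ++ [y]` (`pfx = [η₁,…,η_j]`, `j ≥ 1`) is `C_A(pfx) · G_{A∖pfx}(y, w)`; divided by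
`G_A(η₁, w)` this is `P_{A,a,b}{η^{j+1} = [a₋] ++ pfx ++ [y]}`, and together with
`leWeight_append_cons` it identifies the conditional law of the remainder with `P_{A_j,a_j,b}`.
[cite: LawlerViklund2021, §2.3] -/
theorem prefixMass_eq (A : Set (Site 2)) (x : Site 2) (p : List (Site 2)) (y w : Site 2)
    (hch : List.IsChain (siteGraph A).Adj (x :: p ++ [y])) (hnd : (x :: p ++ [y]).Nodup) :
    (∑' rest : List (Site 2),
        if (y :: rest).getLast? = some w then leWeight A (x :: p ++ y :: rest) else 0) =
      prefixWeight A (x :: p) * rwGreen (siteGraph (A \ {v | v ∈ x :: p})) y w := by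
  rw [← tsum_leWeight_eq_rwGreen, ← ENNReal.tsum_mul_left]
  rw [tsum_eq_tsum_cons y (fun L : List (Site 2) =>
      prefixWeight A (x :: p) *
        (if L.head? = some y ∧ L.getLast? = some w then leWeight (A \ {v | v ∈ x :: p}) L else 0))]
  · refine tsum_congr fun rest => ?_
    by_cases h : (y :: rest).getLast? = some w
    · rw [if_pos h, if_pos ⟨rfl, h⟩, leWeight_append_cons A (x :: p) y rest hch hnd]
    · rw [if_neg h, if_neg (fun h' => h h'.2), mul_zero]
  · intro L hL
    by_contra hhead
    apply hL
    rw [if_neg, mul_zero]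
    rintro ⟨h1, -⟩
    exact hhead h1

end ChordalLERW

end Literature.Probability.RandomPlanarGeometry
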